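import Literature.NumberTheory.Automorphic.JacquetNonvanishingOfEmbedding              -- ★ p828676 (this seat): `nontrivial_coinvariants_of_injective_normalizedInd` (+ ★ p828456 `JacquetRankStrictMono`)
import Literature.NumberTheory.Automorphic.U3PrincipalSeriesLettersUnfold              -- ★ p829690 (this seat): N2∕N3 UNFOLDED as theorems (`…_iff`)
import Literature.NumberTheory.Automorphic.U3PrincipalSeriesJacquetFiltrationUnfold    -- ★ p829691 (this seat): N1 conjuncts 1–2 unfolded (`finiteDimensional_finrank_eq_two_of_…`)
import Summits.HodgeConjecture.HodgeConjecture.Theorems.F0P2nBorelCharactersUnipotent -- ★ `deltaChar_cmBorel_eq_one` (the `hδ` of Frobenius)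
import Summits.HodgeConjecture.HodgeConjecture.Theorems.F0P3UnipotentLimitCompactOpen   -- ★ p827635 (F0P3-p02 (g8)): `isLimitOfCompactOpen_cmUnipotentU`
import HarnessLib

/-!
# `F0P3U3LengthLeTwoOfEmbeds` — the T3 junction **N3 ⇐ N1 + N2**: the principal series of `U(3)(L⁺_v)` has no chain `0 ⊊ N₁ ⊊ N₂ ⊊ i_G(χ)`

Cell `hodgecm-mathlib`, F0∕P3 «U3-mult», crux H413 (`stmt-HodgeConjecture-24833`); T3 «KeysCaseTwo» pay-down (typ-T3a∕T3b (g0), desk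
F0P3b-plan (g8)); pen A-p01 (g18).  The letter N3 ★ `UnitaryGroup.U3PrincipalSeriesLengthLeTwo` [Casselman1995, Cor. 7.1.2] is DERIVED
— token for token — from the letters N1 ★ `UnitaryGroup.U3PrincipalSeriesJacquetFiltration` [Casselman1995, L. 7.1.1 (a)] (`dim r_B i_G(χ) = 2`)
and N2 ★ `UnitaryGroup.U3PrincipalSeriesConstituentEmbeds` [Casselman1995, Cor. 6.3.9 (b)] (every constituent embeds in `i_G(χ)` or `i_G(wχ)`),
along the road printed in N3's own docstring («N1 + exactness ★ `jacquet_exact_holds` + every constituent of `i_G(χ)` has a non-zero Jacquet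
module»):

* the three letters are first UNFOLDED to theorem-world statements (★ `U3PrincipalSeriesLettersUnfold`: the `def`s' private `_proof_k` constants
  make any direct meeting of two letters at the ≈ 10⁷-node carrier type cost millions of heartbeats — see that file's docstring);
* every constituent of `i_G(χ)` has `r_B ≠ 0`: N2 gives an embedding into `i_G(χ)` or `i_G(wχ)`, both `= normalizedInd (cmBorelTriple L 3 v) ℂ_θ`
  DEFINITIONALLY, so the generic ★ `Representation.nontrivial_coinvariants_of_injective_normalizedInd` (Frobenius, `δ_B|_N = 1` by ★
  `deltaChar_cmBorel_eq_one`) applies by ONE term-mode application;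
* ★ `Representation.not_bot_lt_lt_lt_top_of_finrank_coinvariants_le_two` (`Automorphic/JacquetRankStrictMono`: along `⊥ < N₁ < N₂ < ⊤` the images in
  `r_B i_G(χ)` strictly increase — exactness unconditional for the Borel of `U(3)(L⁺_v)` by ★ `isLimitOfCompactOpen_cmUnipotentU`) then contradicts
  N1's `dim = 2`.

BOOKS EFFECT: in either registered T3 cut, `stub_N3 := u3PrincipalSeriesLengthLeTwo_of_embeds L stub_N1 stub_N2` — N3 stops being a letter.
HONEST LABEL: N1 and N2 remain HYPOTHESES of record (named facts); HC_CM is proved only modulo the printed citations until rung 0 closes.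
[Casselman1995 L. 7.1.1, Cor. 6.3.9 (b), Cor. 7.1.2; BernsteinZelevinsky1977 Thm. 2.8; Rogawski1990 §12.2 p. 173]
-/

set_option autoImplicit false
set_option linter.dupNamespace false

noncomputable section

open NumberField IsDedekindDomain
open Literature.NumberTheory.Automorphic Literature.NumberTheory.Automorphic.UnitaryGroup
open scoped MatrixGroups

namespace Summit.HodgeConjecture.HodgeConjecture.Cruxes.H413.F0P3U3LengthLeTwoOfEmbeds

variable (L : Type) [Field L] [NumberField L] [IsCMField L]

set_option maxHeartbeats 400000 in
/-- **Every constituent of `i_G(χ)` has a non-zero Jacquet module, given N2 (unfolded)** — the hypothesis `h` of the generic ★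
`Representation.not_bot_lt_lt_lt_top_of_finrank_coinvariants_le_two`: N2's representative embeds in `i_G(χ)` or in `i_G(wχ)`; either is a
normalised induction from the Borel, so ★ `Representation.nontrivial_coinvariants_of_injective_normalizedInd` applies (Frobenius: the embedding
is a non-zero `T`-map out of `r_B`). [cite: Casselman1995, Cor. 6.3.9 (b) p. 60; Cor. 6.3.7 p. 59; Thm. 3.2.4 p. 34] [cite: BernsteinZelevinsky1977, Prop. 1.9 (b)] -/
theorem nontrivial_coinvariants_of_isConstituentOf_cmPrincipalSeries
    (hN2 : U3PrincipalSeriesConstituentEmbeds L) (v : HeightOneSpectrum (𝓞 ↥(maximalRealSubfield L)))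
    (hns : ∀ w : PlacesOver L v, IsCMField.complexConj L • w.1 = w.1)
    (χ₁ : (LocalRing L v)ˣ →* ℂˣ) (χ₂ : ↥(normOneUnits (conjLocal L (IsCMField.complexConj L) v)) →* ℂˣ)
    (h1c : Continuous (fun x => ((χ₁ x : ℂˣ) : ℂ))) (h2c : Continuous (fun x => ((χ₂ x : ℂˣ) : ℂ)))
    (c : IrrClass ↥(unitaryGroupOfForm (conjLocal L (IsCMField.complexConj L) v) (cmLocalForm L 3 v)))
    (hc : c.IsConstituentOf (cmPrincipalSeries L 3 v (cmTorusCharPair L v χ₁ χ₂))) :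
    ∃ r : SmoothIrrep ↥(unitaryGroupOfForm (conjLocal L (IsCMField.complexConj L) v) (cmLocalForm L 3 v)),
      IrrClass.mk r = c ∧ Nontrivial ((cmBorelTriple L 3 v).restrict r.ρ).Coinvariants := by
  have key := (U3PrincipalSeriesConstituentEmbeds_iff L).1 hN2 v hns χ₁ χ₂ h1c h2c c hc
  refine key.elim fun r hr => ⟨r, hr.1, ?_⟩
  haveI := r.isIrreducible
  haveI : Nontrivial r.V := IrrClass.nontrivial_of_isIrreducible r.ρ
  haveI := locallyCompactSpace_cmBorelU L 3 v
  exact hr.2.elim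
    (fun h => h.elim fun f hf =>
      Representation.nontrivial_coinvariants_of_injective_normalizedInd (cmBorelTriple L 3 v) r.ρ
        (F0P2nBorelCharactersUnipotent.deltaChar_cmBorel_eq_one L v) r.isSmooth
        ((Representation.trivial ℂ ↥(torusU (conjLocal L (IsCMField.complexConj L) v) (cmLocalForm L 3 v)) ℂ).twist
          (cmTorusCharPair L v χ₁ χ₂)) f hf)
    (fun h => h.elim fun f hf =>
      Representation.nontrivial_coinvariants_of_injective_normalizedInd (cmBorelTriple L 3 v) r.ρ
        (F0P2nBorelCharactersUnipotent.deltaChar_cmBorel_eq_one L v) r.isSmooth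
        ((Representation.trivial ℂ ↥(torusU (conjLocal L (IsCMField.complexConj L) v) (cmLocalForm L 3 v)) ℂ).twist
          (cmWeylTorusCharPair L v χ₁ χ₂)) f hf)

/-- `i_G(χ)` is smooth (a smooth induction: ★ `Representation.isSmooth_smoothInd`, across `cmPrincipalSeries = normalizedInd = smoothIndRep`, `rfl`).
[cite: BernsteinZelevinsky1977, §2.3] -/
theorem isSmooth_cmPrincipalSeries (v : HeightOneSpectrum (𝓞 ↥(maximalRealSubfield L)))
    (χ : ↥(torusU (conjLocal L (IsCMField.complexConj L) v) (cmLocalForm L 3 v)) →* ℂˣ) :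
    (cmPrincipalSeries L 3 v χ).IsSmooth :=
  haveI := locallyCompactSpace_cmBorelU L 3 v
  Representation.isSmooth_smoothInd (cmBorelTriple L 3 v).P
    (Representation.twist
      (((Representation.trivial ℂ ↥(torusU (conjLocal L (IsCMField.complexConj L) v) (cmLocalForm L 3 v)) ℂ).twist χ).comp
        (cmBorelTriple L 3 v).proj) (rootDeltaChar (cmBorelTriple L 3 v).P))

/-- **THE JUNCTION N3 ⇐ N1 + N2** (Casselman's Cor. 7.1.2 for `U(3)(L⁺_v)` at a non-split `v`, derived): given N1 (`r_B i_G(χ)` is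
two-dimensional) and N2 (every constituent embeds in `i_G(χ)` or `i_G(wχ)`, hence has `r_B ≠ 0`), there is no chain `⊥ < N₁ < N₂ < ⊤` of
subrepresentations of `i_G(χ)`.  Proof in theorem-world (★ `U3PrincipalSeriesLengthLeTwo_iff`, ★ `finiteDimensional_finrank_eq_two_of_…`) by ★
`Representation.not_bot_lt_lt_lt_top_of_finrank_coinvariants_le_two` with exactness unconditional (★ `isLimitOfCompactOpen_cmUnipotentU`).
[cite: Casselman1995, Cor. 7.1.2 p. 67] [cite: BernsteinZelevinsky1977, Thm. 2.8] [cite: Rogawski1990, §12.2 p. 173] -/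
theorem u3PrincipalSeriesLengthLeTwo_of_embeds (hN1 : U3PrincipalSeriesJacquetFiltration L)
    (hN2 : U3PrincipalSeriesConstituentEmbeds L) : U3PrincipalSeriesLengthLeTwo L := by
  refine (U3PrincipalSeriesLengthLeTwo_iff L).2 fun v hns χ₁ χ₂ h1c h2c => ?_
  have key := finiteDimensional_finrank_eq_two_of_U3PrincipalSeriesJacquetFiltration L hN1 v hns χ₁ χ₂ h1c h2c
  exact @Representation.not_bot_lt_lt_lt_top_of_finrank_coinvariants_le_two _ _ _ _ (cmBorelTriple L 3 v) _ _ _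
    (cmPrincipalSeries L 3 v (cmTorusCharPair L v χ₁ χ₂))
    (F0P3UnipotentLimitCompactOpen.isLimitOfCompactOpen_cmUnipotentU L v) (isSmooth_cmPrincipalSeries L v (cmTorusCharPair L v χ₁ χ₂))
    (nontrivial_coinvariants_of_isConstituentOf_cmPrincipalSeries L hN2 v hns χ₁ χ₂ h1c h2c) key.1 key.2.le

end Summit.HodgeConjecture.HodgeConjecture.Cruxes.H413.F0P3U3LengthLeTwoOfEmbeds

end
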